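import Mathlib
import HarnessLib

/-!
# Non-square descent — THE STEINBERG-BLOCK KERNELS of the census remarks R-k2g36-1 and R-k2g36-2 («abelian-square rigidity», «descent of GNS to the cubic tower»):
# on an `𝔽₂[S₃]`-module killed by `1 + σ + σ²`, a `σ`-fixed vector is `0`, a vector fixed by two transpositions is `0`, and a non-zero vector has a
# non-zero `(1 + τ)`-norm on some `⟨σ⟩`-translate — line `nonsquare-descent` (S4 / GNS reformulations), seed crux `SignedMuSeedAtTwoPlus`
# stmt-BirchSwinnertonDyer-21438 (parent Kμ⁺ `SignedMuVanishingAtTwoPlus` stmt-BirchSwinnertonDyer-20689, route ResidualThetaTransportAtTwo),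
# census `Cruxes/SignedMuSeedAtTwoPlus/IDEATION-CENSUS-k2g36.md` («type R-k2g36-1 and R-k2g36-2 as Theorems helpers — bookkeeping a prover can land»)

Cell `bsd-wall`, width seat `bsd-wall-rtt-p4-w2` g19 (`--supports`, closes nothing).  THEOREMS ONLY; BSD is not proved by this and nothing
arithmetic is asserted: linear algebra of two endomorphisms `σ`, `τ` of a module `V` with the `S₃`-relations `σ³ = 1`, `τ² = 1`, `τσ = σ²τ`, on
which `2 = 0` and the norm `1 + σ + σ²` of the `3`-cycle vanishes (the STEINBERG block `𝔽₂[S₃]/(1 + σ + σ²) ≅ M₂(𝔽₂)`; in the card: `V = V_m ⊆ M_m^×/□`,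
the `χ`-part of units modulo squares, `σ` a generator of `Gal(M_m/K_m)`, `τ` complex-conjugation-type transpositions, `L_m = M_m^{τ}`).

* R-k2g36-1 kernel: **`eq_zero_of_sigma_fixed`** — `σv = v ⟹ v = 0` (`3v = v`).  (The arithmetic half — Kummer theory makes `σ` act trivially on `V` inside
  an extension abelian over `K` — is not here.)
* R-k2g36-2 kernels: `sigma_sq_fixed_iff`, **`eq_zero_of_fixed_of_fixed`** (fixed by the transpositions `τ` and `στ` ⟹ `0`), `eq_zero_of_fixed_of_fixed'`
  (`τ` and `σ²τ`), **`exists_norm_translate_ne_zero`** — `v ≠ 0 ⟹ σⁱv + τ(σⁱv) ≠ 0` for some `i ∈ {0,1,2}` («GNS(m) ⟺ `N_{M_m/L_m}(u_m^g) ≠ 0` in `M_m^×/□`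
  for some `g ∈ Gal(M_m/K_m)`», `N_{M_m/L_m} = 1 + τ`), and the converse bookkeeping `norm_translate_eq_zero_of_eq_zero`.

[folklore]
-/

set_option autoImplicit false
-- the Theorems namespace of this sub repeats the summit name by design (D-0017 nested layout)
set_option linter.dupNamespace false

namespace Summit.BirchSwinnertonDyer.BirchSwinnertonDyer.Theorems.SignedMuAtTwo.NonsquareDescent

universe u v

section Steinberg

variable {R : Type u} [CommRing R] {V : Type v} [AddCommGroup V] [Module R V] (σ τ : V →ₗ[R] V)
  (h2 : ∀ v : V, v + v = 0) (hσ3 : ∀ v : V, σ (σ (σ v)) = v) (hN : ∀ v : V, v + σ v + σ (σ v) = 0)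

include h2 in
/-- In characteristic `2`, `w + τw = 0 ↔ τw = w`. [folklore] -/
theorem add_eq_zero_iff_fixed (w : V) : w + τ w = 0 ↔ τ w = w := by
  constructor
  · intro h
    have h' : w + τ w = w + w := by rw [h, h2]
    exact (add_left_cancel h').symm ▸ rfl
  · intro h
    rw [h, h2]

include h2 hN in
/-- **R-k2g36-1 kernel: a `σ`-fixed vector of the Steinberg block is `0`** (`0 = v + σv + σ²v = 3v = v`). [folklore] -/
theorem eq_zero_of_sigma_fixed {v : V} (hv : σ v = v) : v = 0 := by
  have h := hN v
  rw [hv, hv, h2, zero_add] at h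
  exact h

include hσ3 in
/-- `σ²v = v ↔ σv = v` (`σ³ = 1`). [folklore] -/
theorem sigma_sq_fixed_iff (v : V) : σ (σ v) = v ↔ σ v = v := by
  constructor
  · intro h
    have h' := congrArg σ h
    rw [hσ3] at h'
    exact h'.symm
  · intro h
    rw [h, h]

include h2 hN in
/-- **R-k2g36-2 kernel: a vector fixed by the two transpositions `τ` and `στ` is `0`** (then `σv = σ(τv) = v`). [folklore] -/
theorem eq_zero_of_fixed_of_fixed {v : V} (hτ : τ v = v) (hστ : σ (τ v) = v) : v = 0 := by
  rw [hτ] at hστ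
  exact eq_zero_of_sigma_fixed σ h2 hN hστ

include h2 hσ3 hN in
/-- The same for the pair `τ`, `σ²τ`. [folklore] -/
theorem eq_zero_of_fixed_of_fixed' {v : V} (hτ : τ v = v) (hσστ : σ (σ (τ v)) = v) : v = 0 := by
  rw [hτ, sigma_sq_fixed_iff σ hσ3] at hσστ
  exact eq_zero_of_sigma_fixed σ h2 hN hσστ

variable (hτσ : ∀ v : V, τ (σ v) = σ (σ (τ v)))

include h2 hσ3 hN hτσ in
/-- **R-k2g36-2: a non-zero vector has a non-zero `(1+τ)`-norm on some `⟨σ⟩`-translate** — if `σⁱv + τ(σⁱv) = 0` for `i = 0, 1, 2` then `v = 0`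
(`τ` fixes `v` and `σv`, and `τσv = σ²τv = σ²v`, so `σv = σ²v`, `σv = v`).  («`x ≠ 0` in `V_m` ⟺ `N_{M_m/L_m}(x^g) ≠ 0` for some `g ∈ Gal(M_m/K_m)`».)
[folklore] -/
theorem exists_norm_translate_ne_zero {v : V} (hv : v ≠ 0) :
    v + τ v ≠ 0 ∨ σ v + τ (σ v) ≠ 0 ∨ σ (σ v) + τ (σ (σ v)) ≠ 0 := by
  by_contra h
  push Not at h
  obtain ⟨h0, h1, -⟩ := h
  rw [add_eq_zero_iff_fixed τ h2] at h0 h1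
  -- `τσv = σ²τv = σ²v`, so `σv = σ²v`, i.e. `σ` fixes `σv`... hence `σv = 0`... hence `v = 0`
  rw [hτσ, h0] at h1
  -- h1 : σ (σ v) = σ v
  have hfix : σ (σ v) = σ v := h1
  have hσv : σ v = 0 := eq_zero_of_sigma_fixed σ h2 hN (v := σ v) hfix
  have : v = 0 := by
    have h3 := hσ3 v
    rw [hσv, map_zero, map_zero] at h3
    exact h3.symm
  exact hv this

/-- Converse bookkeeping: for `v = 0` all three norms vanish. [folklore] -/
theorem norm_translate_eq_zero_of_eq_zero {v : V} (hv : v = 0) :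
    v + τ v = 0 ∧ σ v + τ (σ v) = 0 ∧ σ (σ v) + τ (σ (σ v)) = 0 := by
  subst hv
  simp only [map_zero, add_zero, and_self]

end Steinberg

end Summit.BirchSwinnertonDyer.BirchSwinnertonDyer.Theorems.SignedMuAtTwo.NonsquareDescent
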